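import Summits.CriticalPhenomena.SAWScalingLimit.Theses.SAWTwistedSelfEnergy
import Summits.CriticalPhenomena.SAWScalingLimit.Theses.SAWRenewalTightness
import Summits.CriticalPhenomena.SAWScalingLimit.Theses.SAWParafermion
import Summits.CriticalPhenomena.SAWScalingLimit.Theses.SAWLaplacianWalk
import Summits.CriticalPhenomena.SAWScalingLimit.Theses.SAWConfRestriction
import Summits.CriticalPhenomena.SAWScalingLimit.Theorems.SAWRenewalTightnessRoomPassageDefs
import Summits.CriticalPhenomena.SAWScalingLimit.Theorems.SAWRenewalTightnessRoomPassageEvents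
import Summits.CriticalPhenomena.SAWScalingLimit.Theorems.SAWTwistedSelfEnergyParaMartingaleDefs
import Summits.CriticalPhenomena.SAWScalingLimit.Theorems.SAWTwistedSelfEnergySubseqIdentificationParaDoobMartingale
import Summits.CriticalPhenomena.SAWScalingLimit.Theorems.SAWTwistedSelfEnergySubseqIdentificationExistsLatticeRooted
import Summits.CriticalPhenomena.SAWScalingLimit.Theorems.SAWTwistedSelfEnergySubseqIdentificationParaExplorationData
import Summits.CriticalPhenomena.SAWScalingLimit.Theorems.SAWTwistedSelfEnergySubseqIdentificationParaObsNatural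
import Summits.CriticalPhenomena.SAWScalingLimit.Theorems.SAWTwistedSelfEnergySubseqIdentificationParaCharacterisesSLE
import Summits.CriticalPhenomena.SAWScalingLimit.Theorems.SAWRenewalTightnessSubseqIdentificationSawNoReturn
import Literature.Probability.RandomPlanarGeometry.SAWExplorationRunningMax
import Literature.Probability.Process.StoppedValuePairing
import Summits.CriticalPhenomena.SAWScalingLimit.Theorems.SubseqIdentification.Negative.Necessity
import Summits.CriticalPhenomena.SAWScalingLimit.Theorems.SubseqIdentification.Negative.EndpointLoadBearing
import Summits.CriticalPhenomena.SAWScalingLimit.Theorems.SubseqIdentification.Negative.DescribabilityNecessity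
import Literature.Probability.RandomPlanarGeometry.LatticeSlitIncrements
import Literature.Probability.RandomPlanarGeometry.LoewnerChain
import Literature.Probability.RandomPlanarGeometry.LoewnerDescription
import Literature.Probability.RandomPlanarGeometry.SLEConvergenceCriterion
import Literature.Probability.RandomPlanarGeometry.ParaObservableSLESix
import HarnessLib

/-!
# Line `parafermionic-martingale` for crux `SubseqIdentification` (stmt-CriticalPhenomena-0783)
# — registered by the crux-strategist seat b1 (route `SAWTwistedSelfEnergy`, BEFORE the lead), 2026-08-17.

**Lead reshape r-c6-1 (prover-line-stmt-CriticalPhenomena-0783-c6-0, PICKED this line 2026-08-17T13:4xZ).**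
(i) The vocabulary (`contObs`, `contPartition`, `pastObs`, `paraDoob`, `IsRootedApprox`, `hullParaObs`, `paraObs`,
`paraObsCap`) LANDED as `Theorems/SAWTwistedSelfEnergyParaMartingaleDefs.lean` (p163840) and is now IMPORTED (the local
copies are gone), so every stub file and this skeleton speak about the same constants. (ii) ROOT CLAUSE REPAIRED: the
existence stub S5 over `IsRootedApprox` (a `ℤ²`-neighbour of the source with mesh point outside the OPEN domain) is not
provable from plane topology for wild Jordan boundaries (exterior fjords thinner than the mesh can shield islands of lattice
points at every scale, so that no vertex of `Ω_δ` near `a` has such a neighbour); what the observable needs is only that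
the fictitious incoming step `a'_δ → a_δ` is NOT an edge of `Ω_δ` (no U-turn at the first step ⇒ the winding of `a' → γ` is
a continuous functional; the missing edge certifies the complement of the discrete domain within `δ` of `a_δ`). This is
`IsLatticeRooted` (Defs append p164312, with `isLatticeRooted_of_isRootedApprox`): S2, the passage output and S5 are
restated over it — S2 becomes formally STRONGER (more approximations), S5 becomes PROVABLE (finite argmin over the rooted
vertices of the component of `b_δ` + box connectivity of `δℤ²` + the tree's JCT corollary
`JordanDomain.frontier_subset_closure_exterior'`). (iii) S3 `stub_paraPassage` is registered in EXPANDED form (no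
skeleton-local names), so that a Theorems file can prove it verbatim. Composition unchanged.

**Lead reshape r-c6-2 (same seat, after wave 1, 15:2xZ).** LANDED: S1 `stub_paraDoobMartingale` (p167616, helper p166823),
S5 `stub_existsRootedApprox` (p166209), the far-field/short-time Literature layer of S4 (p166579 `SAWParaObservableFarField`,
p166585 `SAWParaObservableShortTime`). S3 `stub_paraPassage` was reported `stub-misstated` by its worker with a kernel-checked
SPLIT and a FORMULATION FINDING: S3 needs a NO-RETURN antecedent (S2 (2) is guarded by `noReturnEvent` and the driver layer needs
`NoReturnAlong`, which is NOT derivable from describability of `μ` from `a`; the room line's `SAWNoReturn` — LANDED from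
`LimitsDescribable`, `RoomEntropy.stub_sawNoReturn` p118403 — supplies it and the composition already has `LimitsDescribable` in
scope). New shape: `ParaPassage := ParaDoobMartingale → SlitParaObservableUniform → SAWNoReturn → ParaMartingaleLimitCap`, proved
(sorry-free glue `stub_paraPassage`) from S3a `stub_paraLatticeDrivers` (para twin of the room line's OPEN driver stub
`stub_sawLatticeDriversApprox`, fidelity on `hullParaObs`, strong capacity clause over all available continuations — XL, open,
generic lattice Loewner theory), S3b `stub_paraExplorationData` (LANDED p167838 + p167303: per-scale exploration data — the Doob
observable FROZEN at the first bad prefix is an exact complex martingale by S1, bounded by S2 (1), with the dichotomy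
`(G_σ = Q_j ∧ G_τ = Q_k) ∨ Q_k = 0`; the brief's deterministic "capped dead-step lemma" is FALSE in general and is not used) and
S3c `stub_paraPassageAssembly` (diagonal passage, port of `stub_roomPassageAssemblyNRPos`; L/XL provable now; its natural-filtration
step LANDED p167950). Stubs now: closed S1 S3b S5 / open S2 (bet) S3a (open driver layer) S3c (provable) S4 (lead, in progress).
**r-c6-3 (16:0xZ):** S4 `stub_paraObservableCharacterisesSLECap` LANDED (p168572) and closed by name. Remaining `sorry`: S2 (the
bet), S3a (open driver layer), S3c (provable, worker in flight). The crux is now kernel-reduced to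
`S2 ∧ S3a ∧ S3c ∧ LimitsDescribable ∧ EndpointRobust` with S1, S3b, S4, S5 PROVED.
**r-c6-4 (cycle 2, 19:3xZ):** S3c's layers LANDED (p168674 Data, p168778 Functional, p168908 Level; assembly pending). S3a
RESHAPED into three registered stubs with a sorry-free glue `paraLatticeDrivers_holds`: S3a-geo `stub_paraLatticeDriversGeom`
(the functional-free driver core: consistency, convergence in law, GEOMETRIC fidelity of Loewner map / derivative / driver value
against `hydroFun K_k`, its derivative, `ξ_k` — XL, open, the one statement that would also serve the room line's H1), S3a-cont
`stub_paraFidelityOfGeom` (deterministic continuity of the hull functional in the geometric data, capped regime, aspect bound —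
M, provable now), S3a-cap `stub_paraCapacityControl` (capacity passes every horizon and available one-step increments are small,
along a describable weak limit — L, provable now, `𝒱`-free). Clause (3) of `ParaLatticeDrivers` (hence hypothesis 1 of S3c) is
WEAKENED to `Im w ≥ ρ ∧ ‖w‖ ≤ ρ⁻¹` (a uniform continuity modulus needs a bounded aspect ratio `‖w‖/Im w`; the assembly S3c takes
`ρ ≤ min (Im w) ‖w‖⁻¹` along its diagonal, so nothing is lost). Sorries: S2, S3a-geo, S3a-cont, S3a-cap, S3c.
# It never touches the live skeletons `Lines/boundary_area_law.lean` (lead c4) / `Lines/room_entropy_wright_fisher.lean`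
# (lead c1) nor their stubs; it REUSES their landed passage vocabulary (`prefixAt`, `capTimeOf`, `noReturnEvent`).

THE CRUX (fixed; shared body `SAWTwistedSelfEnergy.SubseqIdentification = SAWRenewalTightness.SubseqIdentification
= SAWParafermion.SubseqIdentification = …`): every probability subsequential weak limit `μ` (along `s → 0⁺`) of the
critical `δℤ²` SAW laws of a Dobrushin domain `(D; a, b)` with endpoint approximation is the chordal SLE_{8/3} law.

THE LINE — the route's OWN observable as the exploration martingale (the classical martingale-observable road,
Smirnov / CDHKS / LSW, whose continuum and passage halves the tree has PROVED for `κ = 3, 16/3, 6`: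
`ParaObservableSLESix`, `ObservableLimitPassage`, `ObservableDrivingMartingales`, `isSLELaw_of_isLocalMartingale_driving_of_ae_tendsto`).
For a ROOTED approximation (`a_δ` adjacent to a lattice point `a'_δ` outside `D`, the phase reference of the
route's target `ObservableLimitFlat`) and a past `l = γ[0,n]` with tip `v`, put

  `A(l, z) = Σ_{ω : v → z SAW of Ω_δ avoiding l}  x_c^{|ω|} e^{-i(5/8) W(a'_δ, l ⊕ ω)}`   (the route's spin-5/8 parafermion of the slit
                                                                                      domain `Ω_δ ∖ l`, rooted at the tip, phases continued from `a'_δ`),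
  `B(l)    = Σ_{ω : v → b_δ SAW of Ω_δ avoiding l} x_c^{|ω|}`                         (unphased partition function to `b_δ`),
  `M(l, z) = A(l, z)/B(l)`,   `Q_n(γ, z) = M(γ[0,n], z) / M(γ[0,0], z)`               (`paraDoob`).

(1) `Q_n` is an EXACT martingale of the exploration filtration under `SAW.law` (domain Markov property:
`P(γ ⊒ l) = x_c^n B(l)/B(∅)`, first-step decomposition of `A`) as long as no neighbour of the tip is dead for `b_δ`
but alive for `z` — which never happens at capped capacity (hull height `≤ Im w/2`) — `stub_paraDoobMartingale`,
PROVABLE NOW. (2) THE BET (`stub_slitParaObservableUniform`, = the slit-uniform, normalisation-free form of the route's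
target `ObservableLimitFlat` that its engine `DomainTransfer` must deliver: Smirnov's theorem shape "uniformly over
all discrete domains"): deterministically, uniformly over all pasts of capped capacity along walks that do not return
to the root, `Q_n(γ, z_δ)` is within `ε` of the hull functional
  `N(K, ξ, w) = (w² g_K'(w)/(g_K(w) - ξ)²)^{5/8}`   (`hullParaObs`; `K` = hull of the past read through a chordal
uniformizer `φ`, `ξ` its driving value, `z_δ → φ(w)`), and uniformly bounded. In `Q_n` EVERYTHING LOCAL CANCELS: the
`b`-boundary lattice factor (Kennedy–Lawler) between times `n` and `0`, the tip-local factor between `A` and `B` at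
equal times, the lattice constant `C` and the phase conventions between `M_n` and `M_0` — no flat boundary piece, no
boundary normalisation, no `C`. (3) Passage (`stub_paraPassage`, XL transfer, the room line's r7–r9 machinery verbatim with
the para functional: lattice drivers, optional stopping at capacity steps, `PassageUI` p101958, joint continuity of the
capped functional): the time-capped continuum observables `N_t(w) = (w² g_t'(w)/(g_t(w) - W_t)²)^{5/8}`, `t ≤ (Im w)²/16`,
of a describable subsequential limit are martingales. (4) Capped endgame (`stub_paraObservableCharacterisesSLECap`, L,
port of `ParaObservableSLESix` / `RoomEntropyCharacterisesSLECap` p105444): far field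
`N = 1 + (5/4) W/w + (45/32)(W² - (8/3) t)/w² + O(w⁻³)` ⇒ `W`, `W² - (8/3)t` martingales ⇒ Lévy ⇒ `IsSLELaw (8/3)`.
(5) `stub_existsRootedApprox` (lattice topology of Jordan domains): every Dobrushin domain has a rooted approximation;
general approximations are reached through the shared item `SAWConfRestriction.EndpointRobust` (stmt-0776, BY NAME).

  S1 ParaDoobMartingale (provable now, M)  S2 SlitParaObservableUniform (THE BET; route engine)  S3 ParaPassage (XL transfer)
  S4 ParaObservableCharacterisesSLECap (L, known technique)  S5 ExistsRootedApprox (M/L lattice topology)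
  + `LimitsDescribable` (stmt-4481, NECESSARY: Negative/DescribabilityNecessity) + `EndpointRobust` (stmt-0776) BY NAME
  ⟹ `SubseqIdentification` BY NAME (`SubseqIdentification_of`, kernel-checked, no `sorry` outside `stub_*`).

DISPROOF USED (`Cruxes/SubseqIdentification/Disproof.lean` v8, NO KILL; Negative/{Necessity, EndpointLoadBearing,
DescribabilityNecessity} imported so this file is checked against them): `_false_without_fstLimit/_sndLimit` — both endpoint
limits are consumed (S2/S3 pin `φ(0) = a` through `IsRootedApprox.1.tendsto_fst` and describability-from-`a`, `b = φ(∞)` through the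
hydrodynamic normalisation); `_false_without_oneSided/_meshToZero` — every lattice statement is along `𝓝[>] 0`; §6b describability
necessity — `LimitsDescribable` is taken by name (a corollary of the crux, nothing lost); §5 reversibility debt and §6 tightness
necessity are not touched (no tightness input: the crux is "the conjunct minus tightness" and the line keeps it so).
-/

noncomputable section

open MeasureTheory Filter Topology Set
open scoped NNReal ENNReal Classical BigOperators

namespace Summit.CriticalPhenomena.SAWScalingLimit.Cruxes.SubseqIdentification.ParafermionicMartingale

open Literature.Probability.LatticeModels
open Literature.Probability.RandomPlanarGeometry
open UpperHalfPlane (upperHalfPlaneSet)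
open Summit.CriticalPhenomena.SAWScalingLimit.Theses.SAWTwistedSelfEnergy (SubseqIdentification)
open Summit.CriticalPhenomena.SAWScalingLimit.Theses.SAWLaplacianWalk (LimitsDescribable)
open Summit.CriticalPhenomena.SAWScalingLimit.Theses.SAWConfRestriction (EndpointRobust)
open Summit.CriticalPhenomena.SAWScalingLimit.Theorems.SubseqIdentification.RoomEntropy
  (prefixAt capTimeOf noReturnEvent WeakLimitAlong NoReturnAlong frozenDriver)
open scoped PathBorel

open Summit.CriticalPhenomena.SAWScalingLimit.Theorems.SubseqIdentification.ParaMartingale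

/-! ## The named statements of the line -/

/-- **S1 (provable now).** The exact one-step martingale identity of `Q_n` on the cylinders of the exploration
filtration: for a list of vertices `l` not containing `z`, if every neighbour `u ∉ l` of the tip from which `z` can be
reached by a SAW avoiding `l` can also reach `b` by a SAW avoiding `l` (no step is dead for `b` but alive for `z`), then
`∫_{γ ⊒ l} Q_{n+1} = ∫_{γ ⊒ l} Q_n` (`γ ⊒ l`: the first `n+1` vertices of `γ` are `l`). Domain Markov property of the
`x_c^{|γ|}` weights + first-step decomposition of `A`. -/
def ParaDoobMartingale : Prop :=
  ∀ (D : DobrushinDomain) (δ : ℝ) (a a' b z : Site 2) (n : ℕ) (l : List (Site 2)), 0 < δ → z ∉ l →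
    l.length = n + 1 →
    (∀ v u : Site 2, l.getLast? = some v → (discreteDomainGraph D.carrier δ).Adj v u → u ∉ l →
      (∃ ω : SAW.DomainSAW D.carrier δ u z, ∀ y ∈ ω.walk.support, y ∉ l) →
      ∃ ω : SAW.DomainSAW D.carrier δ u b, ∀ y ∈ ω.walk.support, y ∉ l) →
    ∫ γ in {γ : SAW.DomainSAW D.carrier δ a b | γ.walk.support.take (n + 1) = l},
        paraDoob D δ a a' b z γ (n + 1) ∂(SAW.law D.carrier δ a b) =
      ∫ γ in {γ : SAW.DomainSAW D.carrier δ a b | γ.walk.support.take (n + 1) = l},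
        paraDoob D δ a a' b z γ n ∂(SAW.law D.carrier δ a b)

/-- **S2 (THE BET; the route's engine output in Smirnov form).** Slit-uniform convergence of the Doob-normalised
parafermionic observable: for a lattice-rooted approximation (`IsLatticeRooted`, r-c6-1), a chordal uniformizer `φ`, a point `w ∈ ℍ` and lattice points
`z_δ → φ(w)`: (1) a uniform bound on `Q_n(γ, z_δ)` over all pasts of capacity `≤ (Im w)²/16`, all small `δ`; (2) for every
`ε` a root scale `R` such that for all `0 < r < R` and all small `δ`, along every walk that does not come back within
`r` of `a` after reaching distance `R`, at EVERY past of capacity `≤ (Im w)²/16`, `Q_n(γ, z_δ)` is within `ε` of the hull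
functional `N(K_n, ξ_n, w)` of the past read through `φ` (`LatticeSlit.pastHull / drivingValue`). -/
def SlitParaObservableUniform : Prop :=
  ∀ (D : DobrushinDomain) (a a' b : ℝ → Site 2) (φ : ConformalEquiv upperHalfPlaneSet D.carrier),
    IsLatticeRooted D a a' b → D.IsChordalUniformizing φ →
    ∀ w : ℂ, 0 < w.im → ∀ (zδ : ℝ → Site 2),
      Tendsto (fun δ => meshPoint δ (zδ δ)) (𝓝[>] (0 : ℝ)) (𝓝 (φ w)) →
      (∃ C : ℝ, ∀ᶠ δ in 𝓝[>] (0 : ℝ), ∀ (γ : SAW.DomainSAW D.carrier δ (a δ) (b δ)) (k : ℕ),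
          LatticeSlit.capTime φ (prefixAt γ k) ≤ w.im ^ 2 / 16 →
          ‖paraDoob D δ (a δ) (a' δ) (b δ) (zδ δ) γ k‖ ≤ C) ∧
      ∀ ε : ℝ, 0 < ε → ∃ R : ℝ, 0 < R ∧ ∀ r : ℝ, 0 < r → r < R → ∀ᶠ δ in 𝓝[>] (0 : ℝ),
        ∀ (γ : SAW.DomainSAW D.carrier δ (a δ) (b δ)), γ ∉ noReturnEvent D δ (a δ) (b δ) R r →
          ∀ k : ℕ, LatticeSlit.capTime φ (prefixAt γ k) ≤ w.im ^ 2 / 16 →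
            ‖paraDoob D δ (a δ) (a' δ) (b δ) (zδ δ) γ k -
                hullParaObs (LatticeSlit.pastHull φ (prefixAt γ k)) (LatticeSlit.drivingValue φ (prefixAt γ k)) w‖
              ≤ ε

/-- **The time-capped parafermionic martingales of a describable subsequential limit** (output of the passage). -/
def ParaMartingaleLimitCap : Prop :=
  ∀ (D : DobrushinDomain) (a a' b : ℝ → Site 2)
      (φ : ConformalEquiv upperHalfPlaneSet D.carrier) (μ : Measure (CurveClass ℂ)),
      IsLatticeRooted D a a' b → D.IsChordalUniformizing φ → IsProbabilityMeasure μ →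
      IsSubseqLimitLaw (fun δ (γ : SAW.DomainSAW D.carrier δ (a δ) (b δ)) => γ.curve)
        (fun δ => SAW.law D.carrier δ (a δ) (b δ)) μ →
      (∀ᵐ c ∂μ, IsLoewnerDescribable φ c ∧ c.source = D.pt 0) →
      ∃ 𝓕 : Filtration ℝ≥0 (inferInstance : MeasurableSpace (CurveClass ℂ)),
        Adapted 𝓕 (fun t c => drivingFunction φ c t) ∧
        ∀ w : ℂ, 0 < w.im →
          Martingale (fun t c => paraObsCap (drivingFunction φ c) w t) 𝓕 μ

/-- **No return to the root along mesh sequences carrying a weak limit** (the room line's `SAWNoReturn`, verbatim; LANDED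
from `LimitsDescribable` as `RoomEntropy.stub_sawNoReturn`, p118403): the third antecedent of the passage (r-c6-2). -/
def SAWNoReturn : Prop :=
  ∀ (D : DobrushinDomain) (a b : ℝ → Site 2), SAW.IsEndpointApprox D a b →
      ∀ (μ : Measure (CurveClass ℂ)) (s : ℕ → ℝ), IsProbabilityMeasure μ →
        Tendsto s atTop (𝓝[>] (0 : ℝ)) → WeakLimitAlong D a b μ s → NoReturnAlong D a b s

/-- **S3a (r-c6-2, clause (3) weakened r-c6-4 to `‖w‖ ≤ ρ⁻¹`; XL — para twin of the room line's `SAWLatticeDriversApprox`).**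
Threshold-`S₀` approximate lattice drivers with PARA fidelity and the strong capacity clause; PROVED below from the split
S3a-geo / S3a-cont / S3a-cap (`paraLatticeDrivers_holds`, sorry-free glue). -/
def ParaLatticeDrivers : Prop :=
    ∀ (D : DobrushinDomain) (a b : ℝ → Site 2) (φ : ConformalEquiv upperHalfPlaneSet D.carrier),
      SAW.IsEndpointApprox D a b → D.IsChordalUniformizing φ →
      ∀ ρ : ℝ, 0 < ρ → ∀ (μ : Measure (CurveClass ℂ)) (s : ℕ → ℝ) [IsProbabilityMeasure μ]
        [∀ n, IsProbabilityMeasure (SAW.law D.carrier (s n) (a (s n)) (b (s n)))],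
        Tendsto s atTop (𝓝[>] (0 : ℝ)) → WeakLimitAlong D a b μ s →
        (∀ᵐ c ∂μ, IsLoewnerDescribable φ c ∧ c.source = D.pt 0) → NoReturnAlong D a b s →
        ∃ S₀ : ℝ≥0, 0 < S₀ ∧ (S₀ : ℝ) ≤ ρ ∧
        ∃ 𝒱 : (δ : ℝ) → SAW.DomainSAW D.carrier δ (a δ) (b δ) → C(ℝ≥0, ℝ),
          (∀ᶠ n in atTop, ∀ (γ γ' : SAW.DomainSAW D.carrier (s n) (a (s n)) (b (s n))) (k : ℕ),
            (prefixAt γ k).support = (prefixAt γ' k).support →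
            (S₀ : ℝ) ≤ LatticeSlit.capTime φ (prefixAt γ k) →
            ∀ u : ℝ≥0, (u : ℝ) ≤ LatticeSlit.capTime φ (prefixAt γ k) →
              𝒱 (s n) γ u = 𝒱 (s n) γ' u) ∧
          TendstoInDistribution (fun n γ => 𝒱 (s n) γ) atTop (frozenDriver φ S₀)
            (fun n => SAW.law D.carrier (s n) (a (s n)) (b (s n))) μ ∧
          (∀ w : ℂ, ρ ≤ w.im → ‖w‖ ≤ ρ⁻¹ → ∀ᶠ n in atTop,
            SAW.law D.carrier (s n) (a (s n)) (b (s n))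
              {γ | ∃ k : ℕ, (S₀ : ℝ) ≤ LatticeSlit.capTime φ (prefixAt γ k) ∧
                LatticeSlit.capTime φ (prefixAt γ k) ≤ w.im ^ 2 / 16 ∧
                ρ < ‖paraObsCap (𝒱 (s n) γ) w (LatticeSlit.capTime φ (prefixAt γ k)).toNNReal -
                  hullParaObs (LatticeSlit.pastHull φ (prefixAt γ k))
                    (LatticeSlit.drivingValue φ (prefixAt γ k)) w‖}
              ≤ ENNReal.ofReal ρ) ∧
          ∀ T ε : ℝ, 0 < ε → ∀ᶠ n in atTop,
            SAW.law D.carrier (s n) (a (s n)) (b (s n))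
              {γ | (∀ k : ℕ, LatticeSlit.capTime φ (prefixAt γ k) ≤ T) ∨
                ∃ (k : ℕ) (u : Site 2), LatticeSlit.capTime φ (prefixAt γ k) ≤ T ∧
                  ε < LatticeSlit.capIncrement φ (prefixAt γ k) u} ≤ ENNReal.ofReal ε

/-- **S3a-geo (r-c6-4; XL, open — the GEOMETRIC core of the driver layer, functional-free; the one statement that
would serve the room line's H1 as well).** Same hypotheses and the same `S₀`, `𝒱` as `ParaLatticeDrivers`, with exact
prefix-consistency beyond `S₀` and convergence in law to `frozenDriver φ S₀`, but fidelity stated GEOMETRICALLY: outside an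
event of probability `≤ ρ`, at every past with `S₀ ≤ capacity ≤ (Im w)²/16` the Loewner map of `𝒱 γ` at the capacity time,
its derivative at `w`, and the driver value are within `ρ` of the hydrodynamic map `hydroFun K_k` of the past hull, its
derivative, and the lattice driving value `ξ_k` (for `Im w ≥ ρ`, `‖w‖ ≤ ρ⁻¹`). Mechanism (H1 audit C1–C3): causal
construction (`𝒱 γ ≡ ξ_j` up to the first passage `j` of `S₀`, then the conjugated slit driver, frozen at the first post-`j`
stem contact — a return, excluded by `NoReturnAlong`); error `≤ C (S₀ + overshoot)/Im w` from the capacity–displacement bound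
and Cauchy estimates; equicontinuity and identification of the limit by `Loewner.isGeneratedByCurve_of_tendstoLocallyUniformly'`. -/
def ParaLatticeDriversGeom : Prop :=
    ∀ (D : DobrushinDomain) (a b : ℝ → Site 2) (φ : ConformalEquiv upperHalfPlaneSet D.carrier),
      SAW.IsEndpointApprox D a b → D.IsChordalUniformizing φ →
      ∀ ρ : ℝ, 0 < ρ → ∀ (μ : Measure (CurveClass ℂ)) (s : ℕ → ℝ) [IsProbabilityMeasure μ]
        [∀ n, IsProbabilityMeasure (SAW.law D.carrier (s n) (a (s n)) (b (s n)))],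
        Tendsto s atTop (𝓝[>] (0 : ℝ)) → WeakLimitAlong D a b μ s →
        (∀ᵐ c ∂μ, IsLoewnerDescribable φ c ∧ c.source = D.pt 0) → NoReturnAlong D a b s →
        ∃ S₀ : ℝ≥0, 0 < S₀ ∧ (S₀ : ℝ) ≤ ρ ∧
        ∃ 𝒱 : (δ : ℝ) → SAW.DomainSAW D.carrier δ (a δ) (b δ) → C(ℝ≥0, ℝ),
          (∀ᶠ n in atTop, ∀ (γ γ' : SAW.DomainSAW D.carrier (s n) (a (s n)) (b (s n))) (k : ℕ),
            (prefixAt γ k).support = (prefixAt γ' k).support →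
            (S₀ : ℝ) ≤ LatticeSlit.capTime φ (prefixAt γ k) →
            ∀ u : ℝ≥0, (u : ℝ) ≤ LatticeSlit.capTime φ (prefixAt γ k) →
              𝒱 (s n) γ u = 𝒱 (s n) γ' u) ∧
          TendstoInDistribution (fun n γ => 𝒱 (s n) γ) atTop (frozenDriver φ S₀)
            (fun n => SAW.law D.carrier (s n) (a (s n)) (b (s n))) μ ∧
          ∀ w : ℂ, ρ ≤ w.im → ‖w‖ ≤ ρ⁻¹ → ∀ᶠ n in atTop,
            SAW.law D.carrier (s n) (a (s n)) (b (s n))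
              {γ | ∃ k : ℕ, (S₀ : ℝ) ≤ LatticeSlit.capTime φ (prefixAt γ k) ∧
                LatticeSlit.capTime φ (prefixAt γ k) ≤ w.im ^ 2 / 16 ∧
                (ρ < ‖Loewner.map (𝒱 (s n) γ) (LatticeSlit.capTime φ (prefixAt γ k)).toNNReal w -
                      hydroFun (LatticeSlit.pastHull φ (prefixAt γ k)) w‖ ∨
                  ρ < ‖deriv (Loewner.map (𝒱 (s n) γ) (LatticeSlit.capTime φ (prefixAt γ k)).toNNReal) w -
                      deriv (hydroFun (LatticeSlit.pastHull φ (prefixAt γ k))) w‖ ∨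
                  ρ < |𝒱 (s n) γ (LatticeSlit.capTime φ (prefixAt γ k)).toNNReal -
                      LatticeSlit.drivingValue φ (prefixAt γ k)|)}
              ≤ ENNReal.ofReal ρ

/-- **S3a-cont (r-c6-4; M, provable now — deterministic).** The hull functional is uniformly continuous in the geometric
data in the capped regime: for `Im w ≥ ρ`, `‖w‖ ≤ A · Im w`, `16 t ≤ (Im w)²` and a continuous driver `W`, if the Loewner map of
`W` at `w`, its derivative and the driver value `W t` are `η`-close to `hydroFun K w`, `deriv (hydroFun K) w` and `ξ`, then
`‖paraObs W w t - hullParaObs K ξ w‖ ≤ ρ` (`η` depends on `ρ`, `A` only). Short-time facts `‖g_t - W_t‖ ≥ (2/3) Im w`,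
`g_t' = exp(J)`, `|J| ≤ 1/2` (`Loewner.ShortTime`) keep all principal logarithms on one sheet; `‖N_t(w)‖ ≤ C A^{5/4}`
(`norm_paraObs_le`). No hypothesis on `K`, `ξ` is needed: closeness to the driver side places them. -/
def ParaFidelityOfGeom : Prop :=
    ∀ ρ A : ℝ, 0 < ρ → 1 ≤ A → ∃ η : ℝ, 0 < η ∧
      ∀ (W : ℝ≥0 → ℝ) (w : ℂ) (t : ℝ≥0) (K : Set ℂ) (ξ : ℝ), Continuous W → ρ ≤ w.im → ‖w‖ ≤ A * w.im →
        (t : ℝ) ≤ w.im ^ 2 / 16 →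
        ‖Loewner.map W t w - hydroFun K w‖ ≤ η → ‖deriv (Loewner.map W t) w - deriv (hydroFun K) w‖ ≤ η →
        |W t - ξ| ≤ η → ‖paraObs W w t - hullParaObs K ξ w‖ ≤ ρ

/-- **S3a-cap (r-c6-4; L, provable now — `𝒱`-free).** Capacity control along a mesh sequence carrying a describable weak
limit: for every horizon `T` and `ε > 0`, for all large `n`, outside an event of probability `≤ ε` the capacities of the pasts
DO pass `T` and every available one-step continuation of every past of capacity `≤ T` has capacity increment `≤ ε`.
Mechanism (H1 audit C4): a describable class has unbounded capacity and stays away from `b` up to capacity `T`; the lattice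
capacity is lower semicontinuous along uniformly convergent curves (monotonicity of `hcap` + `tendsto_hcap_of_thickening`), so
both requirements pass to the lattice by the portmanteau theorem; away from `b` a one-step continuation lies in an
`ω(δ)`-thickening of the past set (uniform continuity of `φ⁻¹` off `b`), so its increment is uniformly small. -/
def ParaCapacityControl : Prop :=
    ∀ (D : DobrushinDomain) (a b : ℝ → Site 2) (φ : ConformalEquiv upperHalfPlaneSet D.carrier),
      SAW.IsEndpointApprox D a b → D.IsChordalUniformizing φ →
      ∀ (μ : Measure (CurveClass ℂ)) (s : ℕ → ℝ) [IsProbabilityMeasure μ]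
        [∀ n, IsProbabilityMeasure (SAW.law D.carrier (s n) (a (s n)) (b (s n)))],
        Tendsto s atTop (𝓝[>] (0 : ℝ)) → WeakLimitAlong D a b μ s →
        (∀ᵐ c ∂μ, IsLoewnerDescribable φ c ∧ c.source = D.pt 0) →
        ∀ T ε : ℝ, 0 < ε → ∀ᶠ n in atTop,
          SAW.law D.carrier (s n) (a (s n)) (b (s n))
            {γ | (∀ k : ℕ, LatticeSlit.capTime φ (prefixAt γ k) ≤ T) ∨
              ∃ (k : ℕ) (u : Site 2), LatticeSlit.capTime φ (prefixAt γ k) ≤ T ∧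
                ε < LatticeSlit.capIncrement φ (prefixAt γ k) u} ≤ ENNReal.ofReal ε

/-- **S3b (r-c6-2; LANDED p167838).** Per-scale exploration data: the frozen Doob observable as an exact complex martingale of the
exploration filtration, first passages of the capacity clock, measurability of the driver values, and the dichotomy at the passages. -/
def ParaExplorationData : Prop :=
  ∀ (D : DobrushinDomain) (δ : ℝ) (a a' b z : Site 2)
      (φ : ConformalEquiv upperHalfPlaneSet D.carrier)
      [Finite (SAW.DomainSAW D.carrier δ a b)] [IsProbabilityMeasure (SAW.law D.carrier δ a b)]
      (V : SAW.DomainSAW D.carrier δ a b → C(ℝ≥0, ℝ)) (T θ : ℝ) (S₀ s₁ t₁ : ℝ≥0),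
      0 ≤ θ → 0 < S₀ → S₀ ≤ s₁ → s₁ ≤ t₁ → (t₁ : ℝ) + 2 * θ ≤ T →
      (∀ (n : ℕ) (l : List (Site 2)), z ∉ l → l.length = n + 1 →
        (∀ v u : Site 2, l.getLast? = some v → (discreteDomainGraph D.carrier δ).Adj v u → u ∉ l →
          (∃ ω : SAW.DomainSAW D.carrier δ u z, ∀ y ∈ ω.walk.support, y ∉ l) →
          ∃ ω : SAW.DomainSAW D.carrier δ u b, ∀ y ∈ ω.walk.support, y ∉ l) →
        ∫ γ in {γ : SAW.DomainSAW D.carrier δ a b | γ.walk.support.take (n + 1) = l},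
            paraDoob D δ a a' b z γ (n + 1) ∂(SAW.law D.carrier δ a b) =
          ∫ γ in {γ : SAW.DomainSAW D.carrier δ a b | γ.walk.support.take (n + 1) = l},
            paraDoob D δ a a' b z γ n ∂(SAW.law D.carrier δ a b)) →
      (∀ γ : SAW.DomainSAW D.carrier δ a b, LatticeSlit.capTime φ (prefixAt γ 0) ≤ θ) →
      (∀ (γ γ' : SAW.DomainSAW D.carrier δ a b) (k : ℕ),
        (prefixAt γ k).support = (prefixAt γ' k).support →
        (S₀ : ℝ) ≤ LatticeSlit.capTime φ (prefixAt γ k) →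
        ∀ u : ℝ≥0, (u : ℝ) ≤ LatticeSlit.capTime φ (prefixAt γ k) → V γ u = V γ' u) →
      ∃ (𝒢 : Filtration ℕ (inferInstance : MeasurableSpace (SAW.DomainSAW D.carrier δ a b)))
        (σ τ : SAW.DomainSAW D.carrier δ a b → WithTop ℕ) (hσ : IsStoppingTime 𝒢 σ) (M : ℕ)
        (G : ℕ → SAW.DomainSAW D.carrier δ a b → ℂ),
        IsStoppingTime 𝒢 τ ∧ Martingale G 𝒢 (SAW.law D.carrier δ a b) ∧ σ ≤ τ ∧ (∀ γ, τ γ ≤ M) ∧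
        (∀ u, u ≤ s₁ → Measurable[hσ.measurableSpace] fun γ => V γ u) ∧
        (∀ (n : ℕ) (γ : SAW.DomainSAW D.carrier δ a b), ∃ k : ℕ,
          G n γ = paraDoob D δ a a' b z γ k ∧ LatticeSlit.capTime φ (prefixAt γ k) ≤ T) ∧
        ∀ γ : SAW.DomainSAW D.carrier δ a b,
          γ ∉ {γ : SAW.DomainSAW D.carrier δ a b |
                (∀ k : ℕ, LatticeSlit.capTime φ (prefixAt γ k) ≤ T) ∨
                ∃ (k : ℕ) (u : Site 2), LatticeSlit.capTime φ (prefixAt γ k) ≤ T ∧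
                  θ < LatticeSlit.capIncrement φ (prefixAt γ k) u} →
          ∃ j k : ℕ, σ γ = j ∧ τ γ = k ∧
            (s₁ : ℝ) ≤ LatticeSlit.capTime φ (prefixAt γ j) ∧
            LatticeSlit.capTime φ (prefixAt γ j) ≤ s₁ + θ ∧
            (t₁ : ℝ) ≤ LatticeSlit.capTime φ (prefixAt γ k) ∧
            LatticeSlit.capTime φ (prefixAt γ k) ≤ t₁ + θ ∧
            (stoppedValue G σ γ = paraDoob D δ a a' b z γ j ∧
                stoppedValue G τ γ = paraDoob D δ a a' b z γ k ∨
              paraDoob D δ a a' b z γ k = 0)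

/-- **S3c (r-c6-2; L/XL, provable now — port of `stub_roomPassageAssemblyNRPos` with the para functional).**
`ParaLatticeDrivers → ParaExplorationData → ParaDoobMartingale → SlitParaObservableUniform → SAWNoReturn → ParaMartingaleLimitCap`. -/
def ParaPassageAssembly : Prop :=
  ParaLatticeDrivers → ParaExplorationData → ParaDoobMartingale → SlitParaObservableUniform → SAWNoReturn →
    ParaMartingaleLimitCap

/-- **S3 (XL transfer; r-c6-2: with the no-return antecedent).** From the exact lattice martingale (S1), the slit-uniform
observable convergence (S2) and no return to the root along describable mesh sequences (`SAWNoReturn`) to the capped continuum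
martingales of every describable subsequential limit; proved from S3a, S3b, S3c (glue `stub_paraPassage`). -/
def ParaPassage : Prop :=
  ParaDoobMartingale → SlitParaObservableUniform → SAWNoReturn → ParaMartingaleLimitCap

/-- **S4 (L; known technique).** The time-capped parafermionic martingales characterise SLE(8/3): far-field expansion
`N = 1 + (5/4) W/w + (45/32)(W² - (8/3) t)/w² + O(((K + √t)/|w|)³)` at `w = iy`, `y → ∞` ⇒ `W_t` and `W_t² - (8/3) t` are
martingales (`ObservableDrivingMartingales` / `LocalMartingaleFromObservables` pattern) ⇒ Lévy ⇒ `W = √(8/3) B` ⇒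
`IsSLELaw (8/3)` (`isSLELaw_of_isLocalMartingale_driving_of_ae_tendsto`, `8/3 ≠ 8`). Port of `ParaObservableSLESix` (κ = 6)
and of the landed `RoomEntropyCharacterisesSLECap` (p105444). -/
def ParaObservableCharacterisesSLECap : Prop :=
  ∀ (D : DobrushinDomain) (φ : ConformalEquiv upperHalfPlaneSet D.carrier)
      (ν : Measure (CurveClass ℂ)),
      D.IsChordalUniformizing φ → IsProbabilityMeasure ν →
      (∀ᵐ c ∂ν, IsLoewnerDescribable φ c ∧ c.source = D.pt 0) →
      ∀ 𝓕 : Filtration ℝ≥0 (inferInstance : MeasurableSpace (CurveClass ℂ)),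
        Adapted 𝓕 (fun t c => drivingFunction φ c t) →
        (∀ w : ℂ, 0 < w.im →
          Martingale (fun t c => paraObsCap (drivingFunction φ c) w t) 𝓕 ν) →
      IsSLELaw ((8 : ℝ≥0) / 3) D ν

/-- **S5 (M/L lattice topology; r-c6-1: lattice-rooted form).** Every Dobrushin domain that admits an endpoint approximation admits a LATTICE-ROOTED one
(relative form: the given approximation certifies that `Ω_δ` joins the vicinities of `a` and `b`; walk from `a_δ` inside its
component towards the exterior, which accumulates at `a` by the Jordan curve theorem; largest-component bookkeeping of
`meshDomain`). -/
def ExistsRootedApprox : Prop :=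
  ∀ (D : DobrushinDomain) (a b : ℝ → Site 2), SAW.IsEndpointApprox D a b →
    ∃ a₁ a₁' b₁ : ℝ → Site 2, IsLatticeRooted D a₁ a₁' b₁

/-! ## Stubs (registered; `sorry` only here) -/

/-- S1 `stub_paraDoobMartingale` LANDED (p167616, `Theorems/SAWTwistedSelfEnergySubseqIdentificationParaDoobMartingale.lean`,
helper walks file p166823): `ParaDoobMartingale` by name (definitional). -/
theorem paraDoobMartingale_holds : ParaDoobMartingale :=
  Summit.CriticalPhenomena.SAWScalingLimit.Theorems.SubseqIdentification.ParaMartingale.stub_paraDoobMartingale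

/-- STUB S2 (OPEN — THE BET; hardest; the slit-uniform form of the route's target `ObservableLimitFlat`, to be delivered
by the route's engine `DomainTransfer`): `SlitParaObservableUniform`. -/
theorem stub_slitParaObservableUniform :
    ∀ (D : DobrushinDomain) (a a' b : ℝ → Site 2) (φ : ConformalEquiv upperHalfPlaneSet D.carrier),
      IsLatticeRooted D a a' b → D.IsChordalUniformizing φ →
      ∀ w : ℂ, 0 < w.im → ∀ (zδ : ℝ → Site 2),
        Tendsto (fun δ => meshPoint δ (zδ δ)) (𝓝[>] (0 : ℝ)) (𝓝 (φ w)) →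
        (∃ C : ℝ, ∀ᶠ δ in 𝓝[>] (0 : ℝ), ∀ (γ : SAW.DomainSAW D.carrier δ (a δ) (b δ)) (k : ℕ),
            LatticeSlit.capTime φ (prefixAt γ k) ≤ w.im ^ 2 / 16 →
            ‖paraDoob D δ (a δ) (a' δ) (b δ) (zδ δ) γ k‖ ≤ C) ∧
        ∀ ε : ℝ, 0 < ε → ∃ R : ℝ, 0 < R ∧ ∀ r : ℝ, 0 < r → r < R → ∀ᶠ δ in 𝓝[>] (0 : ℝ),
          ∀ (γ : SAW.DomainSAW D.carrier δ (a δ) (b δ)), γ ∉ noReturnEvent D δ (a δ) (b δ) R r →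
            ∀ k : ℕ, LatticeSlit.capTime φ (prefixAt γ k) ≤ w.im ^ 2 / 16 →
              ‖paraDoob D δ (a δ) (a' δ) (b δ) (zδ δ) γ k -
                  hullParaObs (LatticeSlit.pastHull φ (prefixAt γ k)) (LatticeSlit.drivingValue φ (prefixAt γ k)) w‖
                ≤ ε := by
  sorry

/-- `SlitParaObservableUniform` from its registered (expanded) stub (definitional). -/
theorem slitParaObservableUniform_holds : SlitParaObservableUniform := stub_slitParaObservableUniform

/-- STUB S3a-geo (r-c6-4; XL, OPEN — registered): `ParaLatticeDriversGeom` (the functional-free driver core). -/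
theorem stub_paraLatticeDriversGeom :
    ∀ (D : DobrushinDomain) (a b : ℝ → Site 2) (φ : ConformalEquiv upperHalfPlaneSet D.carrier),
      SAW.IsEndpointApprox D a b → D.IsChordalUniformizing φ →
      ∀ ρ : ℝ, 0 < ρ → ∀ (μ : Measure (CurveClass ℂ)) (s : ℕ → ℝ) [IsProbabilityMeasure μ]
        [∀ n, IsProbabilityMeasure (SAW.law D.carrier (s n) (a (s n)) (b (s n)))],
        Tendsto s atTop (𝓝[>] (0 : ℝ)) → WeakLimitAlong D a b μ s →
        (∀ᵐ c ∂μ, IsLoewnerDescribable φ c ∧ c.source = D.pt 0) → NoReturnAlong D a b s →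
        ∃ S₀ : ℝ≥0, 0 < S₀ ∧ (S₀ : ℝ) ≤ ρ ∧
        ∃ 𝒱 : (δ : ℝ) → SAW.DomainSAW D.carrier δ (a δ) (b δ) → C(ℝ≥0, ℝ),
          (∀ᶠ n in atTop, ∀ (γ γ' : SAW.DomainSAW D.carrier (s n) (a (s n)) (b (s n))) (k : ℕ),
            (prefixAt γ k).support = (prefixAt γ' k).support →
            (S₀ : ℝ) ≤ LatticeSlit.capTime φ (prefixAt γ k) →
            ∀ u : ℝ≥0, (u : ℝ) ≤ LatticeSlit.capTime φ (prefixAt γ k) →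
              𝒱 (s n) γ u = 𝒱 (s n) γ' u) ∧
          TendstoInDistribution (fun n γ => 𝒱 (s n) γ) atTop (frozenDriver φ S₀)
            (fun n => SAW.law D.carrier (s n) (a (s n)) (b (s n))) μ ∧
          ∀ w : ℂ, ρ ≤ w.im → ‖w‖ ≤ ρ⁻¹ → ∀ᶠ n in atTop,
            SAW.law D.carrier (s n) (a (s n)) (b (s n))
              {γ | ∃ k : ℕ, (S₀ : ℝ) ≤ LatticeSlit.capTime φ (prefixAt γ k) ∧
                LatticeSlit.capTime φ (prefixAt γ k) ≤ w.im ^ 2 / 16 ∧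
                (ρ < ‖Loewner.map (𝒱 (s n) γ) (LatticeSlit.capTime φ (prefixAt γ k)).toNNReal w -
                      hydroFun (LatticeSlit.pastHull φ (prefixAt γ k)) w‖ ∨
                  ρ < ‖deriv (Loewner.map (𝒱 (s n) γ) (LatticeSlit.capTime φ (prefixAt γ k)).toNNReal) w -
                      deriv (hydroFun (LatticeSlit.pastHull φ (prefixAt γ k))) w‖ ∨
                  ρ < |𝒱 (s n) γ (LatticeSlit.capTime φ (prefixAt γ k)).toNNReal -
                      LatticeSlit.drivingValue φ (prefixAt γ k)|)}
              ≤ ENNReal.ofReal ρ := by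
  sorry

/-- `ParaLatticeDriversGeom` IS its registered stub (definitional). -/
theorem paraLatticeDriversGeom_holds : ParaLatticeDriversGeom := stub_paraLatticeDriversGeom

/-- STUB S3a-cont (r-c6-4; M, PROVABLE NOW — registered): `ParaFidelityOfGeom` (deterministic continuity of the hull
functional in the geometric data, capped regime). -/
theorem stub_paraFidelityOfGeom :
    ∀ ρ A : ℝ, 0 < ρ → 1 ≤ A → ∃ η : ℝ, 0 < η ∧
      ∀ (W : ℝ≥0 → ℝ) (w : ℂ) (t : ℝ≥0) (K : Set ℂ) (ξ : ℝ), Continuous W → ρ ≤ w.im → ‖w‖ ≤ A * w.im →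
        (t : ℝ) ≤ w.im ^ 2 / 16 →
        ‖Loewner.map W t w - hydroFun K w‖ ≤ η → ‖deriv (Loewner.map W t) w - deriv (hydroFun K) w‖ ≤ η →
        |W t - ξ| ≤ η → ‖paraObs W w t - hullParaObs K ξ w‖ ≤ ρ := by
  sorry

/-- `ParaFidelityOfGeom` IS its registered stub (definitional). -/
theorem paraFidelityOfGeom_holds : ParaFidelityOfGeom := stub_paraFidelityOfGeom

/-- STUB S3a-cap (r-c6-4; L, PROVABLE NOW — registered): `ParaCapacityControl` (capacity passes every horizon; available
one-step capacity increments at capped pasts are small; along a describable weak limit). -/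
theorem stub_paraCapacityControl :
    ∀ (D : DobrushinDomain) (a b : ℝ → Site 2) (φ : ConformalEquiv upperHalfPlaneSet D.carrier),
      SAW.IsEndpointApprox D a b → D.IsChordalUniformizing φ →
      ∀ (μ : Measure (CurveClass ℂ)) (s : ℕ → ℝ) [IsProbabilityMeasure μ]
        [∀ n, IsProbabilityMeasure (SAW.law D.carrier (s n) (a (s n)) (b (s n)))],
        Tendsto s atTop (𝓝[>] (0 : ℝ)) → WeakLimitAlong D a b μ s →
        (∀ᵐ c ∂μ, IsLoewnerDescribable φ c ∧ c.source = D.pt 0) →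
        ∀ T ε : ℝ, 0 < ε → ∀ᶠ n in atTop,
          SAW.law D.carrier (s n) (a (s n)) (b (s n))
            {γ | (∀ k : ℕ, LatticeSlit.capTime φ (prefixAt γ k) ≤ T) ∨
              ∃ (k : ℕ) (u : Site 2), LatticeSlit.capTime φ (prefixAt γ k) ≤ T ∧
                ε < LatticeSlit.capIncrement φ (prefixAt γ k) u} ≤ ENNReal.ofReal ε := by
  sorry

/-- `ParaCapacityControl` IS its registered stub (definitional). -/
theorem paraCapacityControl_holds : ParaCapacityControl := stub_paraCapacityControl

/-- **S3a `ParaLatticeDrivers` from the split S3a-geo / S3a-cont / S3a-cap (r-c6-4)** — sorry-free glue: run the geometric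
core at the tolerance `ρ' = min ρ η`, `η = η(ρ, A)` the continuity modulus of S3a-cont for the aspect bound `A = max 1 ρ⁻²`
(every `w` with `Im w ≥ ρ`, `‖w‖ ≤ ρ⁻¹` has `‖w‖ ≤ A · Im w`); a para-fidelity failure at a capped past forces one of the three
geometric failures; the capacity clause is S3a-cap verbatim. -/
theorem paraLatticeDrivers_holds : ParaLatticeDrivers := by
  intro D a b φ happ hφ ρ hρ μ s _ _ hs hweak hdesc hNR
  -- continuity modulus for the aspect bound `A = max 1 ρ⁻²`
  set A : ℝ := max 1 (ρ⁻¹ * ρ⁻¹) with hA_def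
  have hA : 1 ≤ A := le_max_left _ _
  obtain ⟨η, hη, hcont⟩ := paraFidelityOfGeom_holds ρ A hρ hA
  set ρ' : ℝ := min ρ η with hρ'_def
  have hρ' : 0 < ρ' := lt_min hρ hη
  have hρ'ρ : ρ' ≤ ρ := min_le_left _ _
  have hρ'η : ρ' ≤ η := min_le_right _ _
  obtain ⟨S₀, hS₀, hS₀le, 𝒱, hcons, hconv, hgeo⟩ :=
    paraLatticeDriversGeom_holds D a b φ happ hφ ρ' hρ' μ s hs hweak hdesc hNR
  refine ⟨S₀, hS₀, hS₀le.trans hρ'ρ, 𝒱, hcons, hconv, ?_, ?_⟩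
  · intro w hw hwn
    have hwim : 0 < w.im := hρ.trans_le hw
    have hw' : ρ' ≤ w.im := hρ'ρ.trans hw
    have hwn' : ‖w‖ ≤ ρ'⁻¹ := hwn.trans (inv_anti₀ hρ' hρ'ρ)
    have hwA : ‖w‖ ≤ A * w.im := by
      calc ‖w‖ ≤ ρ⁻¹ := hwn
        _ = (ρ⁻¹ * ρ⁻¹) * ρ := by field_simp
        _ ≤ A * w.im := mul_le_mul (le_max_right _ _) hw hρ.le (zero_le_one.trans hA)
    filter_upwards [hgeo w hw' hwn'] with n hn
    refine le_trans (measure_mono ?_) (hn.trans (ENNReal.ofReal_le_ofReal hρ'ρ))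
    rintro γ ⟨k, hk₀, hk₁, hbad⟩
    refine ⟨k, hk₀, hk₁, ?_⟩
    by_contra hgood
    simp only [not_or, not_lt] at hgood
    obtain ⟨h₁, h₂, h₃⟩ := hgood
    have hcapeq : paraObsCap (𝒱 (s n) γ) w (LatticeSlit.capTime φ (prefixAt γ k)).toNNReal =
        paraObs (𝒱 (s n) γ) w (LatticeSlit.capTime φ (prefixAt γ k)).toNNReal := by
      refine paraObsCap_eq ?_
      change (LatticeSlit.capTime φ (prefixAt γ k)).toNNReal ≤ Real.toNNReal (w.im ^ 2 / 16)
      exact Real.toNNReal_le_toNNReal hk₁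
    have hle := hcont (𝒱 (s n) γ) w (LatticeSlit.capTime φ (prefixAt γ k)).toNNReal
      (LatticeSlit.pastHull φ (prefixAt γ k)) (LatticeSlit.drivingValue φ (prefixAt γ k))
      (𝒱 (s n) γ).continuous hw hwA ?_ (h₁.trans hρ'η) (h₂.trans hρ'η) (h₃.trans hρ'η)
    · rw [hcapeq] at hbad
      exact absurd (hbad.trans_le hle) (lt_irrefl _)
    · have h0 : (0 : ℝ) ≤ w.im ^ 2 / 16 := by positivity
      rcases le_or_gt 0 (LatticeSlit.capTime φ (prefixAt γ k)) with hc | hc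
      · rwa [Real.coe_toNNReal _ hc]
      · rw [Real.toNNReal_of_nonpos hc.le]; simpa using h0
  · intro T ε hε
    exact paraCapacityControl_holds D a b φ happ hφ μ s hs hweak hdesc T ε hε

/-- S3b `stub_paraExplorationData` LANDED (p167838, `Theorems/SAWTwistedSelfEnergySubseqIdentificationParaExplorationData.lean`;
helper p167303): `ParaExplorationData` by name (definitional). -/
theorem paraExplorationData_holds : ParaExplorationData :=
  fun D δ a a' b z φ _ _ V T θ S₀ s₁ t₁ =>
    Summit.CriticalPhenomena.SAWScalingLimit.Theorems.SubseqIdentification.ParaMartingale.stub_paraExplorationData D δ a a' b z φ V T θ S₀ s₁ t₁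

/-- STUB S3c (r-c6-2; L/XL, PROVABLE NOW — registered). **S3c (split of `stub_paraPassage`; L/XL, provable now — port of `stub_roomPassageAssemblyNRPos`
with the para functional).** `S3a → S3b → S1 → S2 → SAWNoReturn → ParaMartingaleLimitCap`: the natural
filtration of `W = drivingFunction φ` and the complex cylinder identity of the capped observables
(`Re`/`Im` through `Process.martingale_natural_of_integral_cylinder`; adaptedness and bounds in the
short-time regime `16 t ≤ (Im w)²`); the identity for `0 < s < t < T_w` by diagonalisation in the
tolerance over S3a (fed with `NoReturnAlong` from `SAWNoReturn` along the shifted mesh sequence), the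
per-scale data of S3b (local cylinder identity from S1 with `0 < δ` eventually, stem
capacity from p116522), the uniform bound of S2 (1) for integrability and tails, S2 (2) + para fidelity
for the approximations at the first passages, the `Q_k = 0` branch absorbed into the closed far-driver
event `{sup_{u ≤ T_w} |𝒱 γ u| ≥ Ξ}` (asymptotically small by portmanteau), then `stub_passageUI` with
the bounded jointly continuous functional `(u, W) ↦ paraObsCap W w u`; `s = 0` and `t ≥ T_w` by
right-continuity / freezing. -/
theorem stub_paraPassageAssembly :
    (∀ (D : DobrushinDomain) (a b : ℝ → Site 2) (φ : ConformalEquiv upperHalfPlaneSet D.carrier),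
      SAW.IsEndpointApprox D a b → D.IsChordalUniformizing φ →
      ∀ ρ : ℝ, 0 < ρ → ∀ (μ : Measure (CurveClass ℂ)) (s : ℕ → ℝ) [IsProbabilityMeasure μ]
        [∀ n, IsProbabilityMeasure (SAW.law D.carrier (s n) (a (s n)) (b (s n)))],
        Tendsto s atTop (𝓝[>] (0 : ℝ)) → WeakLimitAlong D a b μ s →
        (∀ᵐ c ∂μ, IsLoewnerDescribable φ c ∧ c.source = D.pt 0) → NoReturnAlong D a b s →
        ∃ S₀ : ℝ≥0, 0 < S₀ ∧ (S₀ : ℝ) ≤ ρ ∧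
        ∃ 𝒱 : (δ : ℝ) → SAW.DomainSAW D.carrier δ (a δ) (b δ) → C(ℝ≥0, ℝ),
          (∀ᶠ n in atTop, ∀ (γ γ' : SAW.DomainSAW D.carrier (s n) (a (s n)) (b (s n))) (k : ℕ),
            (prefixAt γ k).support = (prefixAt γ' k).support →
            (S₀ : ℝ) ≤ LatticeSlit.capTime φ (prefixAt γ k) →
            ∀ u : ℝ≥0, (u : ℝ) ≤ LatticeSlit.capTime φ (prefixAt γ k) →
              𝒱 (s n) γ u = 𝒱 (s n) γ' u) ∧
          TendstoInDistribution (fun n γ => 𝒱 (s n) γ) atTop (frozenDriver φ S₀)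
            (fun n => SAW.law D.carrier (s n) (a (s n)) (b (s n))) μ ∧
          (∀ w : ℂ, ρ ≤ w.im → ‖w‖ ≤ ρ⁻¹ → ∀ᶠ n in atTop,
            SAW.law D.carrier (s n) (a (s n)) (b (s n))
              {γ | ∃ k : ℕ, (S₀ : ℝ) ≤ LatticeSlit.capTime φ (prefixAt γ k) ∧
                LatticeSlit.capTime φ (prefixAt γ k) ≤ w.im ^ 2 / 16 ∧
                ρ < ‖paraObsCap (𝒱 (s n) γ) w (LatticeSlit.capTime φ (prefixAt γ k)).toNNReal -
                  hullParaObs (LatticeSlit.pastHull φ (prefixAt γ k))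
                    (LatticeSlit.drivingValue φ (prefixAt γ k)) w‖}
              ≤ ENNReal.ofReal ρ) ∧
          ∀ T ε : ℝ, 0 < ε → ∀ᶠ n in atTop,
            SAW.law D.carrier (s n) (a (s n)) (b (s n))
              {γ | (∀ k : ℕ, LatticeSlit.capTime φ (prefixAt γ k) ≤ T) ∨
                ∃ (k : ℕ) (u : Site 2), LatticeSlit.capTime φ (prefixAt γ k) ≤ T ∧
                  ε < LatticeSlit.capIncrement φ (prefixAt γ k) u} ≤ ENNReal.ofReal ε) →
    (∀ (D : DobrushinDomain) (δ : ℝ) (a a' b z : Site 2)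
      (φ : ConformalEquiv upperHalfPlaneSet D.carrier)
      [Finite (SAW.DomainSAW D.carrier δ a b)] [IsProbabilityMeasure (SAW.law D.carrier δ a b)]
      (V : SAW.DomainSAW D.carrier δ a b → C(ℝ≥0, ℝ)) (T θ : ℝ) (S₀ s₁ t₁ : ℝ≥0),
      0 ≤ θ → 0 < S₀ → S₀ ≤ s₁ → s₁ ≤ t₁ → (t₁ : ℝ) + 2 * θ ≤ T →
      (∀ (n : ℕ) (l : List (Site 2)), z ∉ l → l.length = n + 1 →
        (∀ v u : Site 2, l.getLast? = some v → (discreteDomainGraph D.carrier δ).Adj v u → u ∉ l →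
          (∃ ω : SAW.DomainSAW D.carrier δ u z, ∀ y ∈ ω.walk.support, y ∉ l) →
          ∃ ω : SAW.DomainSAW D.carrier δ u b, ∀ y ∈ ω.walk.support, y ∉ l) →
        ∫ γ in {γ : SAW.DomainSAW D.carrier δ a b | γ.walk.support.take (n + 1) = l},
            paraDoob D δ a a' b z γ (n + 1) ∂(SAW.law D.carrier δ a b) =
          ∫ γ in {γ : SAW.DomainSAW D.carrier δ a b | γ.walk.support.take (n + 1) = l},
            paraDoob D δ a a' b z γ n ∂(SAW.law D.carrier δ a b)) →
      (∀ γ : SAW.DomainSAW D.carrier δ a b, LatticeSlit.capTime φ (prefixAt γ 0) ≤ θ) →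
      (∀ (γ γ' : SAW.DomainSAW D.carrier δ a b) (k : ℕ),
        (prefixAt γ k).support = (prefixAt γ' k).support →
        (S₀ : ℝ) ≤ LatticeSlit.capTime φ (prefixAt γ k) →
        ∀ u : ℝ≥0, (u : ℝ) ≤ LatticeSlit.capTime φ (prefixAt γ k) → V γ u = V γ' u) →
      ∃ (𝒢 : Filtration ℕ (inferInstance : MeasurableSpace (SAW.DomainSAW D.carrier δ a b)))
        (σ τ : SAW.DomainSAW D.carrier δ a b → WithTop ℕ) (hσ : IsStoppingTime 𝒢 σ) (M : ℕ)
        (G : ℕ → SAW.DomainSAW D.carrier δ a b → ℂ),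
        IsStoppingTime 𝒢 τ ∧ Martingale G 𝒢 (SAW.law D.carrier δ a b) ∧ σ ≤ τ ∧ (∀ γ, τ γ ≤ M) ∧
        (∀ u, u ≤ s₁ → Measurable[hσ.measurableSpace] fun γ => V γ u) ∧
        (∀ (n : ℕ) (γ : SAW.DomainSAW D.carrier δ a b), ∃ k : ℕ,
          G n γ = paraDoob D δ a a' b z γ k ∧ LatticeSlit.capTime φ (prefixAt γ k) ≤ T) ∧
        ∀ γ : SAW.DomainSAW D.carrier δ a b,
          γ ∉ {γ : SAW.DomainSAW D.carrier δ a b |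
                (∀ k : ℕ, LatticeSlit.capTime φ (prefixAt γ k) ≤ T) ∨
                ∃ (k : ℕ) (u : Site 2), LatticeSlit.capTime φ (prefixAt γ k) ≤ T ∧
                  θ < LatticeSlit.capIncrement φ (prefixAt γ k) u} →
          ∃ j k : ℕ, σ γ = j ∧ τ γ = k ∧
            (s₁ : ℝ) ≤ LatticeSlit.capTime φ (prefixAt γ j) ∧
            LatticeSlit.capTime φ (prefixAt γ j) ≤ s₁ + θ ∧
            (t₁ : ℝ) ≤ LatticeSlit.capTime φ (prefixAt γ k) ∧
            LatticeSlit.capTime φ (prefixAt γ k) ≤ t₁ + θ ∧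
            (stoppedValue G σ γ = paraDoob D δ a a' b z γ j ∧
                stoppedValue G τ γ = paraDoob D δ a a' b z γ k ∨
              paraDoob D δ a a' b z γ k = 0)) →
    (∀ (D : DobrushinDomain) (δ : ℝ) (a a' b z : Site 2) (n : ℕ) (l : List (Site 2)), 0 < δ → z ∉ l →
      l.length = n + 1 →
      (∀ v u : Site 2, l.getLast? = some v → (discreteDomainGraph D.carrier δ).Adj v u → u ∉ l →
        (∃ ω : SAW.DomainSAW D.carrier δ u z, ∀ y ∈ ω.walk.support, y ∉ l) →
        ∃ ω : SAW.DomainSAW D.carrier δ u b, ∀ y ∈ ω.walk.support, y ∉ l) →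
      ∫ γ in {γ : SAW.DomainSAW D.carrier δ a b | γ.walk.support.take (n + 1) = l},
          paraDoob D δ a a' b z γ (n + 1) ∂(SAW.law D.carrier δ a b) =
        ∫ γ in {γ : SAW.DomainSAW D.carrier δ a b | γ.walk.support.take (n + 1) = l},
          paraDoob D δ a a' b z γ n ∂(SAW.law D.carrier δ a b)) →
    (∀ (D : DobrushinDomain) (a a' b : ℝ → Site 2) (φ : ConformalEquiv upperHalfPlaneSet D.carrier),
      IsLatticeRooted D a a' b → D.IsChordalUniformizing φ →
      ∀ w : ℂ, 0 < w.im → ∀ (zδ : ℝ → Site 2),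
        Tendsto (fun δ => meshPoint δ (zδ δ)) (𝓝[>] (0 : ℝ)) (𝓝 (φ w)) →
        (∃ C : ℝ, ∀ᶠ δ in 𝓝[>] (0 : ℝ), ∀ (γ : SAW.DomainSAW D.carrier δ (a δ) (b δ)) (k : ℕ),
            LatticeSlit.capTime φ (prefixAt γ k) ≤ w.im ^ 2 / 16 →
            ‖paraDoob D δ (a δ) (a' δ) (b δ) (zδ δ) γ k‖ ≤ C) ∧
        ∀ ε : ℝ, 0 < ε → ∃ R : ℝ, 0 < R ∧ ∀ r : ℝ, 0 < r → r < R → ∀ᶠ δ in 𝓝[>] (0 : ℝ),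
          ∀ (γ : SAW.DomainSAW D.carrier δ (a δ) (b δ)), γ ∉ noReturnEvent D δ (a δ) (b δ) R r →
            ∀ k : ℕ, LatticeSlit.capTime φ (prefixAt γ k) ≤ w.im ^ 2 / 16 →
              ‖paraDoob D δ (a δ) (a' δ) (b δ) (zδ δ) γ k -
                  hullParaObs (LatticeSlit.pastHull φ (prefixAt γ k))
                    (LatticeSlit.drivingValue φ (prefixAt γ k)) w‖ ≤ ε) →
    (∀ (D : DobrushinDomain) (a b : ℝ → Site 2), SAW.IsEndpointApprox D a b →
      ∀ (μ : Measure (CurveClass ℂ)) (s : ℕ → ℝ), IsProbabilityMeasure μ →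
        Tendsto s atTop (𝓝[>] (0 : ℝ)) → WeakLimitAlong D a b μ s → NoReturnAlong D a b s) →
    ∀ (D : DobrushinDomain) (a a' b : ℝ → Site 2)
      (φ : ConformalEquiv upperHalfPlaneSet D.carrier) (μ : Measure (CurveClass ℂ)),
      IsLatticeRooted D a a' b → D.IsChordalUniformizing φ → IsProbabilityMeasure μ →
      IsSubseqLimitLaw (fun δ (γ : SAW.DomainSAW D.carrier δ (a δ) (b δ)) => γ.curve)
        (fun δ => SAW.law D.carrier δ (a δ) (b δ)) μ →
      (∀ᵐ c ∂μ, IsLoewnerDescribable φ c ∧ c.source = D.pt 0) →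
      ∃ 𝓕 : Filtration ℝ≥0 (inferInstance : MeasurableSpace (CurveClass ℂ)),
        Adapted 𝓕 (fun t c => drivingFunction φ c t) ∧
        ∀ w : ℂ, 0 < w.im →
          Martingale (fun t c => paraObsCap (drivingFunction φ c) w t) 𝓕 μ := by
  sorry

/-- `ParaPassageAssembly` IS its registered stub (definitional). -/
theorem paraPassageAssembly_holds : ParaPassageAssembly := stub_paraPassageAssembly

/-- **S3 `ParaPassage` (with the no-return antecedent) from the split S3a/S3b/S3c** — sorry-free glue; `sorry` enters only
through `stub_paraLatticeDrivers` (S3a) and `stub_paraPassageAssembly` (S3c). -/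
theorem paraPassage_holds : ParaPassage :=
  paraPassageAssembly_holds paraLatticeDrivers_holds paraExplorationData_holds

/-- S4 `stub_paraObservableCharacterisesSLECap` LANDED (p168572, lead c6,
`Theorems/SAWTwistedSelfEnergySubseqIdentificationParaCharacterisesSLE.lean`; far-field / short-time Literature layer p166579,
p166585): `ParaObservableCharacterisesSLECap` by name (definitional). -/
theorem paraObservableCharacterisesSLECap_holds : ParaObservableCharacterisesSLECap :=
  Summit.CriticalPhenomena.SAWScalingLimit.Theorems.SubseqIdentification.ParaMartingale.stub_paraObservableCharacterisesSLECap

/-- S5 `stub_existsRootedApprox` LANDED in its lattice-rooted form (p166209,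
`Theorems/SAWTwistedSelfEnergySubseqIdentificationExistsLatticeRooted.lean`): `ExistsRootedApprox` by name (definitional). -/
theorem existsRootedApprox_holds : ExistsRootedApprox :=
  Summit.CriticalPhenomena.SAWScalingLimit.Theorems.SubseqIdentification.ParaMartingale.stub_existsRootedApprox

/-! ## Composition (sorry-free): the stubs and the shared items `LimitsDescribable` (stmt-4481) and `EndpointRobust`
(stmt-0776) prove the crux BY NAME -/

/-- The SHAPE of the line as one proposition. -/
def LineShape : Prop :=
  ParaPassage → ParaDoobMartingale → SlitParaObservableUniform → ParaObservableCharacterisesSLECap →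
    ExistsRootedApprox → LimitsDescribable → EndpointRobust → SubseqIdentification

/-- **The kernel-checked composition.** Given a probability weak limit `μ` of the SAW curve laws of `(D; a, b)` along
`s → 0⁺`: pick a rooted approximation `(a₁, a₁', b₁)` of `D` (S5, from the given one); by `EndpointRobust` the laws of `(a₁, b₁)` have the same
weak limit `μ` along `s`; `LimitsDescribable` makes `μ`-a.e. class describable from `a` through a chordal uniformizer `φ`;
the passage (S3 over S1, S2 and no-return from `RoomEntropy.stub_sawNoReturn hR`) gives the capped parafermionic martingales; the capped endgame (S4) identifies `μ`. -/
theorem lineShape_holds : LineShape := by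
  intro hP hM hO hI hX hR hE D a b hab s μ hs hμ hlim
  obtain ⟨a₁, a₁', b₁, hroot⟩ := hX D a b hab
  -- transfer of the weak limit to the rooted approximation
  have hlim₁ : ∀ f : BoundedContinuousFunction (CurveClass ℂ) ℝ,
      Tendsto (fun n => ∫ γ, f γ.curve ∂(SAW.law D.carrier (s n) (a₁ (s n)) (b₁ (s n)))) atTop
        (𝓝 (∫ x, f x ∂μ)) := by
    intro f
    have h1 := hlim f
    have h2 := (hE D a b a₁ b₁ hab hroot.1 f).comp hs
    have h3 := h1.sub h2
    simp only [sub_zero] at h3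
    refine h3.congr' (Eventually.of_forall fun n => ?_)
    simp only [Function.comp_apply, sub_sub_cancel]
  have hsub : IsSubseqLimitLaw (fun δ (γ : SAW.DomainSAW D.carrier δ (a₁ δ) (b₁ δ)) => γ.curve)
      (fun δ => SAW.law D.carrier δ (a₁ δ) (b₁ δ)) μ := ⟨s, hs, hlim₁⟩
  obtain ⟨φ, hφ⟩ := MarkedDomain.exists_isChordalUniformizing_holds D
  have hdesc := hR D a₁ b₁ hroot.1 φ hφ μ hμ hsub
  obtain ⟨𝓕, hW, hN⟩ := hP hM hO
    (Summit.CriticalPhenomena.SAWScalingLimit.Theorems.SubseqIdentification.RoomEntropy.stub_sawNoReturn hR) D a₁ a₁' b₁ φ μ hroot hφ hμ hsub hdesc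
  exact hI D φ μ hφ hμ hdesc 𝓕 hW hN

/-- **`SubseqIdentification` from the registered stubs and the shared route items `SAWLaplacianWalk.LimitsDescribable`
(stmt-CriticalPhenomena-4481) and `SAWConfRestriction.EndpointRobust` (stmt-CriticalPhenomena-0776), BY NAME** — the skeleton
theorem audited by `#h21_check_skeleton`: concludes the route decl `SAWTwistedSelfEnergy.SubseqIdentification` BY NAME;
`sorry` enters only through `stub_*`. -/
theorem SubseqIdentification_of (hR : LimitsDescribable) (hE : EndpointRobust) : SubseqIdentification :=
  lineShape_holds paraPassage_holds paraDoobMartingale_holds slitParaObservableUniform_holds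
    paraObservableCharacterisesSLECap_holds existsRootedApprox_holds hR hE

/-- The same skeleton theorem for the decl of the route carrying the live leads (`SAWRenewalTightness`, identical text). -/
theorem SubseqIdentification_of' (hR : LimitsDescribable) (hE : EndpointRobust) :
    Summit.CriticalPhenomena.SAWScalingLimit.Theses.SAWRenewalTightness.SubseqIdentification :=
  SubseqIdentification_of hR hE

/-- … and for the FIRST route wanting the shared crux (`SAWParafermion`, identical text). -/
theorem SubseqIdentification_of'' (hR : LimitsDescribable) (hE : EndpointRobust) :
    Summit.CriticalPhenomena.SAWScalingLimit.Theses.SAWParafermion.SubseqIdentification :=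
  SubseqIdentification_of hR hE

end Summit.CriticalPhenomena.SAWScalingLimit.Cruxes.SubseqIdentification.ParafermionicMartingale

end
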